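import Summits.KontsevichZagierPeriods.KontsevichZagierPeriods.Theorems.RootDecompZetaThreeFrontierWordFacesThreeP2

/-!
# Route A‴ — item 32433, line `gz_ladder`: the four faces of `Δ₃` cancel, part 3/4 (lens-1 g11 §22f)

Landing of the decomp-kz lens-1 generation-11 node (HOME/decomp-kz-lens-1/g11/WordLayer.lean §22, critic decomp-kz-crit-1 g3
CLEARED 2026-08-30T13:32:36Z: farm rc 0 / 0 warn / 0 sorry, axioms standard on `…GZLadder.stub_three_wlog`), in the form of the
lens's self-contained module `s22_scratch_WordMovesNamespace.lean` (sha256 453fc31fbca24adc…, imports ONLY the landed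
`…Theorems.RootDecompZetaThreeFrontierWordMoves`), split mechanically into ≤ 400-line parts by the census seat
(decomp-kz-census-1 g8).  Mathematics unchanged.  Part 3 = the four face theorems `face3_t2`, `face3_t12`, `face3_t01`, `face3_t0`,
`faces3_cancel` and `isReduced_of_isGZ_three` (= the registered stub `gz_ladder.stub_three_wlog` unfolded; part 4 states it by name).
-/

noncomputable section

set_option linter.dupNamespace false

open Set MeasureTheory MvPolynomial
open Literature.NumberTheory.Transcendental
open Literature.ModelTheory.ExponentialFields (IsSemialgebraic)

namespace Summit.KontsevichZagierPeriods.KontsevichZagierPeriods.Theorems.RootDecompZetaThreeFrontierWordMoves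

section NecessityThree

/-! ### 22f  The four faces of `Δ₃` -/

/-- **face `t₂ = 0`**: integrability forces `t₂^{b₂} ∣ P` -/
theorem face3_t2 (p : MvPolynomial (Fin 3) ℚ) (b₀ b₁ b₂ c₀ c₁ c₂ a₀₁ a₀₂ a₁₂ : ℕ)
    (hint : IntegrableOn (gzf3 p b₀ b₁ b₂ c₀ c₁ c₂ a₀₁ a₀₂ a₁₂) (KZ.openOrderedSimplex 3)) :
    ∃ p₁ : MvPolynomial (Fin 3) ℚ, EqOn (gzf3 p b₀ b₁ b₂ c₀ c₁ c₂ a₀₁ a₀₂ a₁₂)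
      (gzf3 p₁ b₀ b₁ 0 c₀ c₁ c₂ a₀₁ a₀₂ a₁₂) (KZ.openOrderedSimplex 3) := by
  have hsupp : ∀ e ∈ p.support, b₂ ≤ e 2 := by
    refine face_lemma3 (measurableSet_simplex 3) (fun y hy => (gz3_denoms_pos hy).2.2.1.ne')
      (KZ.isOpen_openOrderedSimplex 2) simplex_two_nonempty (fun x => x 1) (fun x hx => snoc_section_three hx)
      (fun x hx => ?_)
      (fun t => t 0 ^ b₀ * t 1 ^ b₁ * (1 - t 0) ^ c₀ * (1 - t 1) ^ c₁ * (1 - t 2) ^ c₂ *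
        (t 0 - t 1) ^ a₀₁ * (t 0 - t 2) ^ a₀₂ * (t 1 - t 2) ^ a₁₂)
      (fun x _ => ?_) (fun x hx => ?_) b₂ p (hint.congr_fun (fun t ht => ?_) (measurableSet_simplex 3))
    · obtain ⟨h1, h10, h0⟩ := (mem_simplex_two_iff x).1 hx
      exact ⟨h1, (h10.trans h0).le⟩
    · show ContinuousAt (fun s : ℝ => x 0 ^ b₀ * x 1 ^ b₁ * (1 - x 0) ^ c₀ * (1 - x 1) ^ c₁ * (1 - s) ^ c₂ *
        (x 0 - x 1) ^ a₀₁ * (x 0 - s) ^ a₀₂ * (x 1 - s) ^ a₁₂) 0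
      exact (by fun_prop : Continuous fun s : ℝ => x 0 ^ b₀ * x 1 ^ b₁ * (1 - x 0) ^ c₀ * (1 - x 1) ^ c₁ * (1 - s) ^ c₂ *
        (x 0 - x 1) ^ a₀₁ * (x 0 - s) ^ a₀₂ * (x 1 - s) ^ a₁₂).continuousAt
    · obtain ⟨h1, h10, h0⟩ := (mem_simplex_two_iff x).1 hx
      show x 0 ^ b₀ * x 1 ^ b₁ * (1 - x 0) ^ c₀ * (1 - x 1) ^ c₁ * (1 - (0:ℝ)) ^ c₂ *
        (x 0 - x 1) ^ a₀₁ * (x 0 - 0) ^ a₀₂ * (x 1 - 0) ^ a₁₂ ≠ 0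
      have : 0 < 1 - x 0 := by linarith
      have : 0 < 1 - x 1 := by linarith
      have : 0 < x 0 - x 1 := by linarith
      have : 0 < x 0 := h1.trans h10
      rw [sub_zero, sub_zero, sub_zero]
      positivity
    · obtain ⟨h0, h1, h2, h3, h4, h5, h6, h7, h8⟩ := gz3_denoms_pos ht
      show gzf3 p b₀ b₁ b₂ c₀ c₁ c₂ a₀₁ a₀₂ a₁₂ t =
        MvPolynomial.aeval t p / (t 2 ^ b₂ * (t 0 ^ b₀ * t 1 ^ b₁ * (1 - t 0) ^ c₀ * (1 - t 1) ^ c₁ * (1 - t 2) ^ c₂ *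
          (t 0 - t 1) ^ a₀₁ * (t 0 - t 2) ^ a₀₂ * (t 1 - t 2) ^ a₁₂))
      rw [gzf3, div_eq_div_iff (by positivity) (by positivity)]
      ring
  obtain ⟨p₁, rfl⟩ := exists_X_pow_mul_fin 2 b₂ p hsupp
  refine ⟨p₁, fun t ht => ?_⟩
  obtain ⟨h0, h1, h2, h3, h4, h5, h6, h7, h8⟩ := gz3_denoms_pos ht
  simp only [gzf3, map_mul, map_pow, MvPolynomial.aeval_X, pow_zero, mul_one]
  rw [div_eq_div_iff (by positivity) (by positivity)]
  ring

/-- **face `t₁ = t₂`**: integrability forces `(t₁-t₂)^{a₁₂} ∣ P` (involution `τ₁₂` to the face `t₂ = 0`) -/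
theorem face3_t12 (p : MvPolynomial (Fin 3) ℚ) (b₀ b₁ c₀ c₁ c₂ a₀₁ a₀₂ a₁₂ : ℕ)
    (hint : IntegrableOn (gzf3 p b₀ b₁ 0 c₀ c₁ c₂ a₀₁ a₀₂ a₁₂) (KZ.openOrderedSimplex 3)) :
    ∃ p₂ : MvPolynomial (Fin 3) ℚ, EqOn (gzf3 p b₀ b₁ 0 c₀ c₁ c₂ a₀₁ a₀₂ a₁₂)
      (gzf3 p₂ b₀ b₁ 0 c₀ c₁ c₂ a₀₁ a₀₂ 0) (KZ.openOrderedSimplex 3) := by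
  have hsupp : ∀ e ∈ (s12P p).support, a₁₂ ≤ e 2 := by
    refine face_lemma3 (measurableSet_simplex 3) (fun y hy => (gz3_denoms_pos hy).2.2.1.ne')
      (KZ.isOpen_openOrderedSimplex 2) simplex_two_nonempty (fun x => x 1) (fun x hx => snoc_section_three hx)
      (fun x hx => ?_)
      (fun u => u 0 ^ b₀ * u 1 ^ b₁ * (1 - u 0) ^ c₀ * (1 - u 1) ^ c₁ * (1 - u 1 + u 2) ^ c₂ *
        (u 0 - u 1) ^ a₀₁ * (u 0 - u 1 + u 2) ^ a₀₂)
      (fun x _ => ?_) (fun x hx => ?_) a₁₂ (s12P p)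
      ((integrableOn_comp_s12 hint).congr_fun (fun u hu => ?_) (measurableSet_simplex 3))
    · obtain ⟨h1, h10, h0⟩ := (mem_simplex_two_iff x).1 hx
      exact ⟨h1, (h10.trans h0).le⟩
    · show ContinuousAt (fun s : ℝ => x 0 ^ b₀ * x 1 ^ b₁ * (1 - x 0) ^ c₀ * (1 - x 1) ^ c₁ * (1 - x 1 + s) ^ c₂ *
        (x 0 - x 1) ^ a₀₁ * (x 0 - x 1 + s) ^ a₀₂) 0
      exact (by fun_prop : Continuous fun s : ℝ => x 0 ^ b₀ * x 1 ^ b₁ * (1 - x 0) ^ c₀ * (1 - x 1) ^ c₁ *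
        (1 - x 1 + s) ^ c₂ * (x 0 - x 1) ^ a₀₁ * (x 0 - x 1 + s) ^ a₀₂).continuousAt
    · obtain ⟨h1, h10, h0⟩ := (mem_simplex_two_iff x).1 hx
      show x 0 ^ b₀ * x 1 ^ b₁ * (1 - x 0) ^ c₀ * (1 - x 1) ^ c₁ * (1 - x 1 + (0:ℝ)) ^ c₂ *
        (x 0 - x 1) ^ a₀₁ * (x 0 - x 1 + 0) ^ a₀₂ ≠ 0
      have : 0 < 1 - x 0 := by linarith
      have : 0 < 1 - x 1 := by linarith
      have : 0 < x 0 - x 1 := by linarith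
      have : 0 < x 0 := h1.trans h10
      rw [add_zero, add_zero]
      positivity
    · obtain ⟨h0, h1, h2, h3, h4, h5, h6, h7, h8⟩ := gz3_denoms_pos hu
      have h9 : 0 < 1 - u 1 + u 2 := by linarith
      have h10 : 0 < u 0 - u 1 + u 2 := by linarith
      show gzf3 p b₀ b₁ 0 c₀ c₁ c₂ a₀₁ a₀₂ a₁₂ (s12 u) =
        MvPolynomial.aeval u (s12P p) / (u 2 ^ a₁₂ * (u 0 ^ b₀ * u 1 ^ b₁ * (1 - u 0) ^ c₀ * (1 - u 1) ^ c₁ *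
          (1 - u 1 + u 2) ^ c₂ * (u 0 - u 1) ^ a₀₁ * (u 0 - u 1 + u 2) ^ a₀₂))
      rw [aeval_s12P, gzf3, s12_zero, s12_one, s12_two, sub_sub_cancel,
        show (1 : ℝ) - (u 1 - u 2) = 1 - u 1 + u 2 by ring, show u 0 - (u 1 - u 2) = u 0 - u 1 + u 2 by ring,
        pow_zero, mul_one, div_eq_div_iff (by positivity) (by positivity)]
      ring
  obtain ⟨q, hq⟩ := exists_X_pow_mul_fin 2 a₁₂ (s12P p) hsupp
  have hp : p = (MvPolynomial.X 1 - MvPolynomial.X 2) ^ a₁₂ * s12P q := by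
    rw [← s12P_s12P p, hq, map_mul, map_pow]
    congr 2
    simp [s12P, MvPolynomial.bind₁_X_right]
  refine ⟨s12P q, fun t ht => ?_⟩
  obtain ⟨h0, h1, h2, h3, h4, h5, h6, h7, h8⟩ := gz3_denoms_pos ht
  rw [hp]
  simp only [gzf3, map_mul, map_pow, map_sub, MvPolynomial.aeval_X, pow_zero, mul_one]
  rw [div_eq_div_iff (by positivity) (by positivity)]
  ring

/-- **face `t₀ = t₁`**: integrability forces `(t₀-t₁)^{a₀₁} ∣ P` (involution `τ₀₁` to the face `t₂ = 0`) -/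
theorem face3_t01 (p : MvPolynomial (Fin 3) ℚ) (b₀ b₁ c₀ c₁ c₂ a₀₁ a₀₂ : ℕ)
    (hint : IntegrableOn (gzf3 p b₀ b₁ 0 c₀ c₁ c₂ a₀₁ a₀₂ 0) (KZ.openOrderedSimplex 3)) :
    ∃ p₃ : MvPolynomial (Fin 3) ℚ, EqOn (gzf3 p b₀ b₁ 0 c₀ c₁ c₂ a₀₁ a₀₂ 0)
      (gzf3 p₃ b₀ b₁ 0 c₀ c₁ c₂ 0 a₀₂ 0) (KZ.openOrderedSimplex 3) := by
  have hsupp : ∀ e ∈ (s01P p).support, a₀₁ ≤ e 2 := by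
    refine face_lemma3 (measurableSet_simplex 3) (fun y hy => (gz3_denoms_pos hy).2.2.1.ne')
      (KZ.isOpen_openOrderedSimplex 2) simplex_two_nonempty (fun x => x 1) (fun x hx => snoc_section_three hx)
      (fun x hx => ?_)
      (fun u => u 0 ^ b₀ * (u 0 - u 2) ^ b₁ * (1 - u 0) ^ c₀ * (1 - u 0 + u 2) ^ c₁ * (1 - u 0 + u 1) ^ c₂ *
        u 1 ^ a₀₂)
      (fun x _ => ?_) (fun x hx => ?_) a₀₁ (s01P p)
      ((integrableOn_comp_s01 hint).congr_fun (fun u hu => ?_) (measurableSet_simplex 3))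
    · obtain ⟨h1, h10, h0⟩ := (mem_simplex_two_iff x).1 hx
      exact ⟨h1, (h10.trans h0).le⟩
    · show ContinuousAt (fun s : ℝ => x 0 ^ b₀ * (x 0 - s) ^ b₁ * (1 - x 0) ^ c₀ * (1 - x 0 + s) ^ c₁ *
        (1 - x 0 + x 1) ^ c₂ * x 1 ^ a₀₂) 0
      exact (by fun_prop : Continuous fun s : ℝ => x 0 ^ b₀ * (x 0 - s) ^ b₁ * (1 - x 0) ^ c₀ * (1 - x 0 + s) ^ c₁ *
        (1 - x 0 + x 1) ^ c₂ * x 1 ^ a₀₂).continuousAt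
    · obtain ⟨h1, h10, h0⟩ := (mem_simplex_two_iff x).1 hx
      show x 0 ^ b₀ * (x 0 - (0:ℝ)) ^ b₁ * (1 - x 0) ^ c₀ * (1 - x 0 + 0) ^ c₁ * (1 - x 0 + x 1) ^ c₂ * x 1 ^ a₀₂ ≠ 0
      have : 0 < 1 - x 0 := by linarith
      have : 0 < 1 - x 0 + x 1 := by linarith
      have : 0 < x 0 := h1.trans h10
      rw [sub_zero, add_zero]
      positivity
    · obtain ⟨h0, h1, h2, h3, h4, h5, h6, h7, h8⟩ := gz3_denoms_pos hu
      have h9 : 0 < 1 - u 0 + u 2 := by linarith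
      have h10 : 0 < 1 - u 0 + u 1 := by linarith
      show gzf3 p b₀ b₁ 0 c₀ c₁ c₂ a₀₁ a₀₂ 0 (s01 u) =
        MvPolynomial.aeval u (s01P p) / (u 2 ^ a₀₁ * (u 0 ^ b₀ * (u 0 - u 2) ^ b₁ * (1 - u 0) ^ c₀ * (1 - u 0 + u 2) ^ c₁ *
          (1 - u 0 + u 1) ^ c₂ * u 1 ^ a₀₂))
      rw [aeval_s01P, gzf3, s01_zero, s01_one, s01_two, sub_sub_cancel, sub_sub_cancel,
        show (1 : ℝ) - (u 0 - u 2) = 1 - u 0 + u 2 by ring, show (1 : ℝ) - (u 0 - u 1) = 1 - u 0 + u 1 by ring,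
        pow_zero, pow_zero, mul_one, mul_one, div_eq_div_iff (by positivity) (by positivity)]
      ring
  obtain ⟨q, hq⟩ := exists_X_pow_mul_fin 2 a₀₁ (s01P p) hsupp
  have hp : p = (MvPolynomial.X 0 - MvPolynomial.X 1) ^ a₀₁ * s01P q := by
    rw [← s01P_s01P p, hq, map_mul, map_pow]
    congr 2
    simp [s01P, MvPolynomial.bind₁_X_right]
  refine ⟨s01P q, fun t ht => ?_⟩
  obtain ⟨h0, h1, h2, h3, h4, h5, h6, h7, h8⟩ := gz3_denoms_pos ht
  rw [hp]
  simp only [gzf3, map_mul, map_pow, map_sub, MvPolynomial.aeval_X, pow_zero, mul_one]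
  rw [div_eq_div_iff (by positivity) (by positivity)]
  ring

/-- **face `t₀ = 1`**: integrability forces `(1-t₀)^{c₀} ∣ P` (duality `σ₃` to the face `t₂ = 0`) -/
theorem face3_t0 (p : MvPolynomial (Fin 3) ℚ) (b₀ b₁ c₀ c₁ c₂ a₀₂ : ℕ)
    (hint : IntegrableOn (gzf3 p b₀ b₁ 0 c₀ c₁ c₂ 0 a₀₂ 0) (KZ.openOrderedSimplex 3)) :
    ∃ p₄ : MvPolynomial (Fin 3) ℚ, EqOn (gzf3 p b₀ b₁ 0 c₀ c₁ c₂ 0 a₀₂ 0)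
      (gzf3 p₄ b₀ b₁ 0 0 c₁ c₂ 0 a₀₂ 0) (KZ.openOrderedSimplex 3) := by
  have hsupp : ∀ e ∈ (duP3 p).support, c₀ ≤ e 2 := by
    refine face_lemma3 (measurableSet_simplex 3) (fun y hy => (gz3_denoms_pos hy).2.2.1.ne')
      (KZ.isOpen_openOrderedSimplex 2) simplex_two_nonempty (fun x => x 1) (fun x hx => snoc_section_three hx)
      (fun x hx => ?_)
      (fun u => (1 - u 2) ^ b₀ * (1 - u 1) ^ b₁ * u 1 ^ c₁ * u 0 ^ c₂ * (u 0 - u 2) ^ a₀₂)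
      (fun x _ => ?_) (fun x hx => ?_) c₀ (duP3 p)
      ((integrableOn_comp_duΦ hint).congr_fun (fun u hu => ?_) (measurableSet_simplex 3))
    · obtain ⟨h1, h10, h0⟩ := (mem_simplex_two_iff x).1 hx
      exact ⟨h1, (h10.trans h0).le⟩
    · show ContinuousAt (fun s : ℝ => (1 - s) ^ b₀ * (1 - x 1) ^ b₁ * x 1 ^ c₁ * x 0 ^ c₂ * (x 0 - s) ^ a₀₂) 0
      exact (by fun_prop : Continuous fun s : ℝ => (1 - s) ^ b₀ * (1 - x 1) ^ b₁ * x 1 ^ c₁ * x 0 ^ c₂ *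
        (x 0 - s) ^ a₀₂).continuousAt
    · obtain ⟨h1, h10, h0⟩ := (mem_simplex_two_iff x).1 hx
      show (1 - (0:ℝ)) ^ b₀ * (1 - x 1) ^ b₁ * x 1 ^ c₁ * x 0 ^ c₂ * (x 0 - 0) ^ a₀₂ ≠ 0
      have : 0 < 1 - x 1 := by linarith
      have : 0 < x 0 := h1.trans h10
      rw [sub_zero, sub_zero]
      positivity
    · obtain ⟨h0, h1, h2, h3, h4, h5, h6, h7, h8⟩ := gz3_denoms_pos hu
      show gzf3 p b₀ b₁ 0 c₀ c₁ c₂ 0 a₀₂ 0 (duΦ u) =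
        MvPolynomial.aeval u (duP3 p) / (u 2 ^ c₀ * ((1 - u 2) ^ b₀ * (1 - u 1) ^ b₁ * u 1 ^ c₁ * u 0 ^ c₂ * (u 0 - u 2) ^ a₀₂))
      rw [aeval_duP3, gzf3, duΦ_zero, duΦ_one, duΦ_two, sub_sub_cancel, sub_sub_cancel, sub_sub_cancel,
        show (1 : ℝ) - u 2 - (1 - u 0) = u 0 - u 2 by ring,
        pow_zero, pow_zero, pow_zero, mul_one, mul_one, mul_one, div_eq_div_iff (by positivity) (by positivity)]
      ring
  obtain ⟨q, hq⟩ := exists_X_pow_mul_fin 2 c₀ (duP3 p) hsupp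
  have hp : p = (MvPolynomial.C 1 - MvPolynomial.X 0) ^ c₀ * duP3 q := by
    rw [← duP3_duP3 p, hq, map_mul, map_pow]
    congr 2
    simp [duP3, MvPolynomial.bind₁_X_right]
  refine ⟨duP3 q, fun t ht => ?_⟩
  obtain ⟨h0, h1, h2, h3, h4, h5, h6, h7, h8⟩ := gz3_denoms_pos ht
  rw [hp]
  simp only [gzf3, map_mul, map_pow, map_sub, MvPolynomial.aeval_X, map_one, pow_zero, mul_one]
  rw [div_eq_div_iff (by positivity) (by positivity)]
  ring

/-- **faces**: an integrable genus-zero integrand on `Δ₃` is a REDUCED form `P'/(t₀^{b₀} t₁^{b₁} (1-t₁)^{c₁} (1-t₂)^{c₂} (t₀-t₂)^{a₀₂})`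
on `Δ₃` — the four face factors cancel into the numerator. -/
theorem faces3_cancel (p : MvPolynomial (Fin 3) ℚ) (b₀ b₁ b₂ c₀ c₁ c₂ a₀₁ a₀₂ a₁₂ : ℕ)
    (hint : IntegrableOn (gzf3 p b₀ b₁ b₂ c₀ c₁ c₂ a₀₁ a₀₂ a₁₂) (KZ.openOrderedSimplex 3)) :
    ∃ p' : MvPolynomial (Fin 3) ℚ, EqOn (gzf3 p b₀ b₁ b₂ c₀ c₁ c₂ a₀₁ a₀₂ a₁₂)
      (fun t => MvPolynomial.aeval t p' / (t 0 ^ b₀ * t 1 ^ b₁ * (1 - t 1) ^ c₁ * (1 - t 2) ^ c₂ * (t 0 - t 2) ^ a₀₂))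
      (KZ.openOrderedSimplex 3) := by
  obtain ⟨p₁, h₁⟩ := face3_t2 p b₀ b₁ b₂ c₀ c₁ c₂ a₀₁ a₀₂ a₁₂ hint
  have hint₁ := hint.congr_fun h₁ (measurableSet_simplex 3)
  obtain ⟨p₂, h₂⟩ := face3_t12 p₁ b₀ b₁ c₀ c₁ c₂ a₀₁ a₀₂ a₁₂ hint₁
  have hint₂ := hint₁.congr_fun h₂ (measurableSet_simplex 3)
  obtain ⟨p₃, h₃⟩ := face3_t01 p₂ b₀ b₁ c₀ c₁ c₂ a₀₁ a₀₂ hint₂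
  have hint₃ := hint₂.congr_fun h₃ (measurableSet_simplex 3)
  obtain ⟨p₄, h₄⟩ := face3_t0 p₃ b₀ b₁ c₀ c₁ c₂ a₀₂ hint₃
  refine ⟨p₄, fun t ht => ?_⟩
  rw [h₁ ht, h₂ ht, h₃ ht, h₄ ht]
  simp only [gzf3, pow_zero, mul_one]

/-- the `GZNormalFormW` / `IsGZ` hypothesis shape at `k = 3` is `gzf3` -/
theorem gzForm_three (p : MvPolynomial (Fin 3) ℚ) (a : Fin 3 → Fin 3 → ℕ) (b c : Fin 3 → ℕ) (t : Fin 3 → ℝ) :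
    MvPolynomial.aeval t p / ((∏ i, t i ^ b i) * (∏ i, (1 - t i) ^ c i) *
      ∏ i, ∏ j, if i < j then (t i - t j) ^ a i j else 1) =
      gzf3 p (b 0) (b 1) (b 2) (c 0) (c 1) (c 2) (a 0 1) (a 0 2) (a 1 2) t := by
  have h01 : ((0 : Fin 3) < 1) := by decide
  have h02 : ((0 : Fin 3) < 2) := by decide
  have h12 : ((1 : Fin 3) < 2) := by decide
  have h00 : ¬ ((0 : Fin 3) < 0) := by decide
  have h10 : ¬ ((1 : Fin 3) < 0) := by decide
  have h11 : ¬ ((1 : Fin 3) < 1) := by decide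
  have h20 : ¬ ((2 : Fin 3) < 0) := by decide
  have h21 : ¬ ((2 : Fin 3) < 1) := by decide
  have h22 : ¬ ((2 : Fin 3) < 2) := by decide
  rw [gzf3]
  congr 1
  simp only [Fin.prod_univ_three, if_pos h01, if_pos h02, if_pos h12, if_neg h00, if_neg h10, if_neg h11, if_neg h20,
    if_neg h21, if_neg h22]
  ring

/-- **ANALYTIC WLOG IN DIMENSION 3** (the content of `gz_ladder.stub_three_wlog`): a genus-zero representation on `Δ₃` is a
REDUCED representation — poles only at `t₀ = 0`, `t₁ = 0`, `t₁ = 1`, `t₂ = 1`, `t₀ = t₂` (two vertices and three edges of `Δ̄₃`). -/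
theorem isReduced_of_isGZ_three (r : KZ.IntegralRep 3) (hd : r.domain = KZ.openOrderedSimplex 3)
    (p : MvPolynomial (Fin 3) ℚ) (a : Fin 3 → Fin 3 → ℕ) (b c : Fin 3 → ℕ)
    (hi : EqOn r.integrand (fun t => MvPolynomial.aeval t p / ((∏ i, t i ^ b i) * (∏ i, (1 - t i) ^ c i) *
      ∏ i, ∏ j, if i < j then (t i - t j) ^ a i j else 1)) r.domain) :
    ∃ (p' : MvPolynomial (Fin 3) ℚ) (β₀ β₁ γ₁ γ₂ α : ℕ), EqOn r.integrand
      (fun t => MvPolynomial.aeval t p' / (t 0 ^ β₀ * t 1 ^ β₁ * (1 - t 1) ^ γ₁ * (1 - t 2) ^ γ₂ * (t 0 - t 2) ^ α))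
      r.domain := by
  have hi3 : EqOn r.integrand (gzf3 p (b 0) (b 1) (b 2) (c 0) (c 1) (c 2) (a 0 1) (a 0 2) (a 1 2))
      (KZ.openOrderedSimplex 3) := by
    intro t ht
    rw [hi (by rw [hd]; exact ht)]
    exact gzForm_three p a b c t
  have hint : IntegrableOn (gzf3 p (b 0) (b 1) (b 2) (c 0) (c 1) (c 2) (a 0 1) (a 0 2) (a 1 2))
      (KZ.openOrderedSimplex 3) :=
    (hd ▸ r.integrableOn).congr_fun hi3 (measurableSet_simplex 3)
  obtain ⟨p', hp'⟩ := faces3_cancel p (b 0) (b 1) (b 2) (c 0) (c 1) (c 2) (a 0 1) (a 0 2) (a 1 2) hint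
  refine ⟨p', b 0, b 1, c 1, c 2, a 0 2, fun t ht => ?_⟩
  have ht' : t ∈ KZ.openOrderedSimplex 3 := by rw [← hd]; exact ht
  rw [hi3 ht', hp' ht']

end NecessityThree

end Summit.KontsevichZagierPeriods.KontsevichZagierPeriods.Theorems.RootDecompZetaThreeFrontierWordMoves
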